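import Mathlib
import Literature.MathematicalPhysics.KineticTheory.HardSphereEuler
import Literature.Analysis.FluidPDE.HardSphereDynamics

/-!
# Sketch — crux-ideate stmt-AtomisticToContinuum-9518 (CollisionalTransferLocality), ideator 3, round 1

First lemmas of the two idea cards `hemisphere-affine-slaving` and `ybg-rigidity-contact-value`,
typed over existing declarations (they need not be proved here; the finite-sum identity is).
-/

open MeasureTheory Filter Set Topology
open scoped RealInnerProductSpace BigOperators

namespace Summit.AtomisticToContinuum.HydrodynamicLimit.Cruxes.CollisionalTransferLocality.Ideator3

noncomputable section

/-- Velocity space. -/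
abbrev V3 : Type := EuclideanSpace ℝ (Fin 3)
/-- Macroscopic torus. -/
abbrev T3 : Type := UnitAddTorus (Fin 3)

/-! ## Card A (`hemisphere-affine-slaving`) -/

/-- **(A1) Hemisphere second-moment identity** (Enskog 1922; Chapman–Cowling 1970 §16.5 (2),
§16.8 (7)–(8)): for every relative velocity `g`,
`∫_{⟪g,ω⟫<0} ⟪g,ω⟫² ω_a ω_b dσ(ω) = (2π/15)(‖g‖² δ_ab + 2 g_a g_b)` on the unit sphere of `ℝ³`
with its surface measure `volume.toSphere` (total mass `4π`). The trace is `(2π/3)‖g‖²`. -/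
def HemisphereSecondMoment : Prop :=
  ∀ (g : V3) (a b : Fin 3),
    ∫ ω : Metric.sphere (0 : V3) 1,
        (if inner ℝ g (ω : V3) < 0 then inner ℝ g (ω : V3) ^ 2 * (ω : V3) a * (ω : V3) b else 0)
      ∂((volume : Measure V3).toSphere)
    = (2 * Real.pi / 15) * (‖g‖ ^ 2 * (if a = b then 1 else 0) + 2 * g a * g b)

/-- **(A1') Hemisphere mixed third-moment identity** (Chapman–Cowling 1970 §16.6): for relative
velocity `g` and centre-of-mass velocity `V`,
`∫_{⟪g,ω⟫<0} ⟪g,ω⟫² ⟪V,ω⟫ ω_a dσ(ω) = (2π/15)(‖g‖² V_a + 2 ⟪g,V⟫ g_a)`. -/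
def HemisphereEnergyMoment : Prop :=
  ∀ (g V : V3) (a : Fin 3),
    ∫ ω : Metric.sphere (0 : V3) 1,
        (if inner ℝ g (ω : V3) < 0 then inner ℝ g (ω : V3) ^ 2 * inner ℝ V (ω : V3) * (ω : V3) a else 0)
      ∂((volume : Measure V3).toSphere)
    = (2 * Real.pi / 15) * (‖g‖ ^ 2 * V a + 2 * inner ℝ g V * g a)

/-- **(A2) Pair sums are one-body central moments** (finite, exact): for any finite velocity sample,
`Σ_k Σ_l (v_k − v_l)_a (v_k − v_l)_b = 2 n Σ_k v_{k,a} v_{k,b} − 2 (Σ_k v_{k,a})(Σ_l v_{l,b})`,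
i.e. `= 2n² Π_ab` with `Π` the empirical central second-moment tensor. This is the step that makes the
TRACE of the chaos-predicted collisional stress a function of the KINETIC temperature for ANY velocity
law, and its traceless part `∝` the kinetic deviator `D`. -/
theorem pair_outer_sum (n : ℕ) (v : Fin n → V3) (a b : Fin 3) :
    ∑ k, ∑ l, (v k a - v l a) * (v k b - v l b)
      = 2 * n * ∑ k, v k a * v k b - 2 * (∑ k, v k a) * (∑ l, v l b) := by
  have hx : ∑ k : Fin n, ∑ l : Fin n, v l a * v k b = (∑ l, v l a) * (∑ k, v k b) := by
    rw [Finset.sum_comm, Finset.sum_mul]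
    refine Finset.sum_congr rfl fun l _ => ?_
    rw [Finset.mul_sum]
  have hy : ∑ k : Fin n, ∑ l : Fin n, v k a * v l b = (∑ k, v k a) * (∑ l, v l b) := by
    rw [Finset.sum_mul]
    refine Finset.sum_congr rfl fun k _ => ?_
    rw [Finset.mul_sum]
  have hz1 : ∑ k : Fin n, ∑ _l : Fin n, v k a * v k b = n * ∑ k, v k a * v k b := by
    simp only [Finset.sum_const, Finset.card_univ, Fintype.card_fin, nsmul_eq_mul, Finset.mul_sum]
  have hz2 : ∑ _k : Fin n, ∑ l : Fin n, v l a * v l b = n * ∑ l, v l a * v l b := by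
    simp only [Finset.sum_const, Finset.card_univ, Fintype.card_fin, nsmul_eq_mul]
  calc ∑ k, ∑ l, (v k a - v l a) * (v k b - v l b)
      = ∑ k, ∑ l, (v k a * v k b + v l a * v l b - v k a * v l b - v l a * v k b) := by
          refine Finset.sum_congr rfl fun k _ => Finset.sum_congr rfl fun l _ => ?_
          ring
    _ = (∑ k, ∑ _l : Fin n, v k a * v k b) + (∑ _k : Fin n, ∑ l, v l a * v l b)
          - (∑ k, ∑ l, v k a * v l b) - (∑ k, ∑ l, v l a * v k b) := by
          simp only [Finset.sum_sub_distrib, Finset.sum_add_distrib]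
    _ = 2 * n * ∑ k, v k a * v k b - 2 * (∑ k, v k a) * (∑ l, v l b) := by
          rw [hx, hy, hz1, hz2]
          ring

/-- **(A3) Affine slaving of the chaos-predicted collisional stress** (the card's load-bearing
identity, a consequence of (A1)+(A2)): for a finite velocity sample `v : Fin n → V3` (`n ≥ 1`) with
mean `ū`, empirical central second-moment tensor `P2_ab = n⁻¹ Σ_k (v_k − ū)_a (v_k − ū)_b` (`Π` in the card),
the pair-and-hemisphere average of the collisional momentum transfer kernel is AFFINE in `Π`:
`n⁻² Σ_k Σ_l ∫_{⟪g_kl,ω⟫<0} ⟪g_kl,ω⟫² ω_a ω_b dσ = (2π/15)(2 (tr Π) δ_ab + 4 Π_ab)`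
(`= (4π/3) θ δ_ab + (8π/15) D_ab` with `θ = tr Π/3`, `D = Π − θ𝟙`: Enskog's factor `2/5`). -/
def ChaosStressAffine : Prop :=
  ∀ (n : ℕ), 0 < n → ∀ (v : Fin n → V3) (a b : Fin 3),
    let ubar : V3 := (n : ℝ)⁻¹ • ∑ k, v k
    let P2 : Fin 3 → Fin 3 → ℝ := fun c e => (n : ℝ)⁻¹ * ∑ k, (v k c - ubar c) * (v k e - ubar e)
    ((n : ℝ) ^ 2)⁻¹ * ∑ k, ∑ l,
        ∫ ω : Metric.sphere (0 : V3) 1,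
          (if inner ℝ (v k - v l) (ω : V3) < 0
            then inner ℝ (v k - v l) (ω : V3) ^ 2 * (ω : V3) a * (ω : V3) b else 0)
          ∂((volume : Measure V3).toSphere)
      = (2 * Real.pi / 15) * (2 * (∑ c, P2 c c) * (if a = b then 1 else 0) + 4 * P2 a b)

/-! ## Card B (`ybg-rigidity-contact-value`) -/

open Literature.Analysis.FluidPDE Literature.MathematicalPhysics.KineticTheory in
/-- **(B1) Position-only invariants of the hard-sphere flow are locally constant** (the integrated,
finite-`N`, ergodicity-free form of YBG rigidity: a stationary law `Ψ(q)·∏ M(vᵢ)` has `Ψ` locally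
constant on the open non-overlap set). For every hard-sphere flow of `N+1` spheres of diameter
`hsDiameter σ N` on `𝕋³` and every continuous function `Ψ` of the POSITIONS only: if `Ψ ∘ pos` is
invariant along every good orbit, then `Ψ` is locally constant at the position configuration of every
good phase point in the open non-overlap set. (Proof idea: from a.e. `(q,v)` the orbit is the free
flight `q + tv` until the first contact, so `Ψ` is constant on a.e. ray out of a.e. `q`, hence on balls
by continuity.) -/
def PositionOnlyInvariantsLocallyConstant (σ : ℝ) (N : ℕ) : Prop :=
  ∀ (Φ : HardSphereFlow (Torus.geometry (Fin 3)) (hsDiameter σ N) (N + 1))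
    (Ψ : (Fin (N + 1) → T3) → ℝ), Continuous Ψ →
    (∀ z ∈ Φ.good, ∀ t : ℝ, Ψ (fun i => (Φ.flow t z i).1) = Ψ (fun i => (z i).1)) →
    ∀ z ∈ Φ.good,
      (∀ i j : Fin (N + 1), i ≠ j →
        hsDiameter σ N < ‖(Torus.geometry (Fin 3)).sepVec (z i).1 (z j).1‖) →
      ∀ᶠ q in 𝓝 (fun i => (z i).1), Ψ q = Ψ (fun i => (z i).1)

open Literature.Analysis.FluidPDE Literature.MathematicalPhysics.KineticTheory in
/-- **(B2) Thermodynamic contact factor** `Y(η) := (Z(η) − 1)/((2π/3)η) = (3/2π)·f_ex′(η)` in the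
tree's normalisation (`hsCompressibility η = 1 + η·deriv hsExcessFreeEnergy η`); the pressure
equation says this IS the contact value of the equilibrium pair correlation; the card's engine
derives the dynamical contact factor `= Y(ρ̄σ³)` from windowed YBG identities + Kirkwood–Salsburg
uniqueness below Ruelle's radius. -/
def contactFactor (η : ℝ) : ℝ := 3 / (2 * Real.pi) * deriv hsExcessFreeEnergy η

open Literature.Analysis.FluidPDE Literature.MathematicalPhysics.KineticTheory in
/-- (B2') `p_c = ρθ(Z(ρσ³) − 1) = (2π/3) ρ²σ³ θ · Y(ρσ³)`: the collisional pressure of the crux in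
contact-factor form (pure algebra from the definitions). -/
theorem hsPressure_sub_ideal (σ ρ θ : ℝ) :
    hsPressure σ ρ θ - ρ * θ = (2 * Real.pi / 3) * ρ ^ 2 * σ ^ 3 * θ * contactFactor (ρ * σ ^ 3) := by
  unfold hsPressure hsCompressibility contactFactor
  have hπ : Real.pi ≠ 0 := Real.pi_ne_zero
  field_simp
  ring

end

end Summit.AtomisticToContinuum.HydrodynamicLimit.Cruxes.CollisionalTransferLocality.Ideator3
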